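import Literature.AlgebraicGeometry.Frobenioids.ArchimedeanF0FSMFactorization
import HarnessLib

/-!
# Frobenioids II, Proposition 3.4 (viii) at the level of `F₀`: the case `F₀ = R₀` of the
# FSMI-factorisation (abc-iut cell, layer L1, node `FrdII:Prop3.4(viii)/P34-L12`, chain LC-L1-2)

Mochizuki, *The geometry of Frobenioids II: poly-Frobenioids*, Kyushu J. Math. **62** (2008)
401–460, §3, Proposition 3.4 (viii), proof, journal p. 427 ll. 6–17 (= kurims p. 32)
[cite: MochizukiFrdII2008, Prop 3.4 (viii) p.32]:

> "I claim that `F₀` is of FSMFF-type. Indeed, let `φ : A → B` be an FSM-morphism of `F₀` …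
> Now suppose that `A`, `B` are complex. Then observe that if the isometric base-isomorphism `φ` is
> linear, then it is an isometric pre-step, hence (cf. the fiberwise-surjectivity of `φ`,
> Lemma 3.2 (ix) and Example 3.3 (v)) either an isomorphism or a slit morphism."

PROOF-ONLY file (nothing defined), sub-DAG row `P34-L12` (`F0FSMFactorsFSMI`), part 2: the rigidified
angloid `R₀ = (N₀)_A` (Example 3.3 (iv)). Exactly as for `N₀` (`ArchimedeanF0FSMFactorization.lean`,
whose `C₀`-level dense-image dichotomy `C0.smul_dir_pow_eq_or_slit_of_fill` is the engine): every
arrow of `R₀` is a linear isometry, a sub-region of a complex object of `R₀` is rigidified through it,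
so fiberwise surjectivity in `R₀` supplies the squares the engine consumes
(`R0.fill_of_isFiberwiseSurjective`); an FSM-morphism between complex objects that is not an
isomorphism is then a slit morphism, and irreducible (`R0.isFSMI_of_isFSM_of_not_isIso`), whence the
printed "factors as a composite of finitely many FSMI-morphisms" (`R0.exists_isFSMIChain_of_isFSM`,
one term). Real objects are excluded as in part 1 (complex regime, RULING R37). No side is taken
on [IUTchIII] Cor. 3.12.
-/

namespace Literature.AlgebraicGeometry.Frobenioids

open CategoryTheory Set
open scoped Pointwise

noncomputable section

namespace ArchFrd

/-! ### `F₀ = R₀`: the rigidified angloid -/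

namespace R0

/-- An arrow of `R₀` whose underlying arrow of `C₀` is invertible is invertible in `R₀`.
[cite: MochizukiFrdII2008, Ex 3.3 (iv) p.29] -/
theorem isIso_of_isIso_homCarrier {P Q : R0} (f : P ⟶ Q) [IsIso (N0.homCarrier f.left)] : IsIso f := by
  haveI : IsIso f.left := N0.isIso_of_isIso_carrier f.left
  haveI : IsIso ((Over.forget N0.realUnit).map f) := by
    change IsIso f.left; infer_instance
  exact isIso_of_reflects_iso f (Over.forget N0.realUnit)

/-- Fiberwise surjectivity of `φ` in `R₀` supplies the squares over sub-region inclusions that the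
`C₀`-level dense-image argument consumes (a sub-region of `Y` is rigidified through `Y`).
[cite: MochizukiFrdII2008, Prop 3.4 (viii) p.32] -/
theorem fill_of_isFiberwiseSurjective {X Y : R0} (φ : X ⟶ Y) (hφ : IsFiberwiseSurjective φ) :
    ∀ (W : C0) (g : W ⟶ Y.left.carrier), C0.degFr g = 1 → C0.scalar g = 1 →
      PreFrobenioid.IsIsometry C0.toElem g →
        ∃ (V : C0) (δX : V ⟶ X.left.carrier) (δW : V ⟶ W),
          δX ≫ N0.homCarrier φ.left = δW ≫ g := by
  intro W g hg1 _ hgiso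
  let WN : N0 := ⟨⟨W⟩⟩
  let γN : WN ⟶ Y.left := N0.homMk (X := WN) g hgiso hg1
  let W' : R0 := Over.mk (γN ≫ Y.hom)
  let γ : W' ⟶ Y := Over.homMk γN rfl
  obtain ⟨V', δX', δW', hsq⟩ := hφ γ
  refine ⟨V'.left.carrier, N0.homCarrier δX'.left, N0.homCarrier δW'.left, ?_⟩
  have := congrArg (fun k : V' ⟶ Y => N0.homCarrier k.left) hsq
  simp only [Over.comp_left, N0.homCarrier_comp] at this
  exact this

/-- **[FrdII] Prop. 3.4 (viii), `F₀ = R₀`, the linear case of the FSMI-factorisation**: an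
FSM-morphism of `R₀` between complex objects that is not an isomorphism is an FSMI-morphism.
[cite: MochizukiFrdII2008, Prop 3.4 (viii) p.32] -/
theorem isFSMI_of_isFSM_of_not_isIso {X Y : R0} (hY : Y.left.carrier.IsComplexObj) (φ : X ⟶ Y)
    (hφ : IsFSM φ) (hφ' : ¬ IsIso φ) : IsFSMI φ := by
  refine ⟨hφ, hφ', fun M β α hfac => ?_⟩
  have hXc : X.left.carrier.IsComplexObj := N0.isComplexObj_of_hom φ.left hY
  have hMc : M.left.carrier.IsComplexObj := N0.isComplexObj_of_hom α.left hY
  have hlin : C0.degFr (N0.homCarrier φ.left) = 1 := φ.left.2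
  have hiso : PreFrobenioid.IsIsometry C0.toElem (N0.homCarrier φ.left) := φ.left.1.2
  have hlinβ : C0.degFr (N0.homCarrier β.left) = 1 := β.left.2
  have hisoβ : PreFrobenioid.IsIsometry C0.toElem (N0.homCarrier β.left) := β.left.1.2
  have hlinα : C0.degFr (N0.homCarrier α.left) = 1 := α.left.2
  have hisoα : PreFrobenioid.IsIsometry C0.toElem (N0.homCarrier α.left) := α.left.1.2
  obtain ⟨A', hA'c, hA't, hA'd, -⟩ :=
    exists_pulledRegion Y.left.carrier (C0.Base (N0.homCarrier φ.left))
  rcases C0.smul_dir_pow_eq_or_slit_of_fill hY (N0.homCarrier φ.left) hA'c hA'd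
      (fill_of_isFiberwiseSurjective φ hφ.1) with hfull | ⟨-, -, z₀, hz₀⟩
  · exfalso
    apply hφ'
    haveI : IsIso (C0.Base (N0.homCarrier φ.left)) := D0.isIso_of_isComplex _ hXc hY
    rw [hlin, PNat.one_coe, pow_one] at hfull
    haveI : IsIso (N0.homCarrier φ.left) :=
      C0.isIso_of_isometry_of_dir _ ⟨hlin, (C0.isBaseIso_iff _).mpr inferInstance⟩ hiso hA'c hA't
        hfull.symm.subset
    exact isIso_of_isIso_homCarrier φ
  · rw [hlin, PNat.one_coe, pow_one] at hz₀
    have hX : X.left.carrier.region.dir =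
        {(unitPart ℂ (C0.scalar (N0.homCarrier φ.left)))⁻¹ • z₀}ᶜ := by
      have := congrArg (fun T => (unitPart ℂ (C0.scalar (N0.homCarrier φ.left)))⁻¹ • T) hz₀
      simp only [inv_smul_smul] at this
      rw [this, Set.smul_set_compl, Set.smul_set_singleton]
    have hfacC : N0.homCarrier β.left ≫ N0.homCarrier α.left = N0.homCarrier φ.left := by
      have := congrArg (fun k : X ⟶ Y => N0.homCarrier k.left) hfac
      simp only [Over.comp_left, N0.homCarrier_comp] at this
      exact this
    obtain ⟨A'', hA''c, hA''t, hA''d, -⟩ :=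
      exists_pulledRegion M.left.carrier (C0.Base (N0.homCarrier β.left))
    have hβdir := (C0.hom_conditions (N0.homCarrier β.left) hA''c).1
    rw [hlinβ, PNat.one_coe, pow_one, hX, Set.smul_set_compl, Set.smul_set_singleton] at hβdir
    haveI : IsIso (C0.Base (N0.homCarrier β.left)) := D0.isIso_of_isComplex _ hXc hMc
    haveI : IsIso (C0.Base (N0.homCarrier α.left)) := D0.isIso_of_isComplex _ hMc hY
    rcases NormOne.eq_univ_or_eq_compl_of_compl_subset hβdir with hMu | hMs
    · left
      have hMiso : M.left.carrier.region.dir = univ :=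
        C0.eq_univ_of_twist_image_eq_univ (C0.Base (N0.homCarrier β.left)) (hA''d ▸ hMu)
      obtain ⟨A₃, hA₃c, hA₃t, -, -⟩ :=
        exists_pulledRegion Y.left.carrier (C0.Base (N0.homCarrier α.left))
      haveI : IsIso (N0.homCarrier α.left) :=
        C0.isIso_of_isometry_of_dir _ ⟨hlinα, (C0.isBaseIso_iff _).mpr inferInstance⟩ hisoα hA₃c
          hA₃t (by rw [hMiso, Set.smul_set_univ]; exact subset_univ _)
      exact isIso_of_isIso_homCarrier α
    · right
      haveI : IsIso (N0.homCarrier β.left) :=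
        C0.isIso_of_isometry_of_dir _ ⟨hlinβ, (C0.isBaseIso_iff _).mpr inferInstance⟩ hisoβ hA''c
          hA''t (by rw [hMs, hX, Set.smul_set_compl, Set.smul_set_singleton])
      exact isIso_of_isIso_homCarrier β

/-- **[FrdII] Prop. 3.4 (viii) for `F₀ = R₀`, condition (a) of FSMFF-type between complex objects**:
every FSM-morphism of the rigidified angloid `R₀` between complex objects that is not an
isomorphism is a (one-term) composite of FSMI-morphisms. [cite: MochizukiFrdII2008, Prop 3.4 (viii) p.32] -/
theorem exists_isFSMIChain_of_isFSM {X Y : R0} (hY : Y.left.carrier.IsComplexObj) (φ : X ⟶ Y)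
    (hφ : IsFSM φ) (hφ' : ¬ IsIso φ) : ∃ n, IsFSMIChain φ n :=
  ⟨1, IsFSMIChain.single φ (isFSMI_of_isFSM_of_not_isIso hY φ hφ hφ')⟩

end R0

end ArchFrd

end

end Literature.AlgebraicGeometry.Frobenioids
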